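import Summits.RiemannHypothesis.RiemannHypothesis.Theorems.JensenPolynomialsTruncatedBinomial
import Summits.RiemannHypothesis.RiemannHypothesis.Theorems.JensenPolynomialsTruncatedBinomialArc

/-!
# Route `JensenPolynomials`, FAR crux `XiWindowZeroFreeRelFar` (B1-rel) — the truncated binomial series, III:
the TWO-BRANCH bound (RH-FREE; cell rh-jensen, HUMAN RULING D-0040; input of the truncation stub `stub_junk` (S2) of
the far-Gumbel skeleton for item `stmt-RiemannHypothesis-19465`)

For `M ≥ 1` and `w ∉ {0, −1}`, `r = ‖w‖`, `N = M − ½`, `C = binom(M−½, M) ≈ (πM)^{−1/2}`: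

  `‖T_M(w) − (1+w)^N‖ ≤ ‖1+w‖^N · C r^{M+1}/(2(M+1)) + ½C r^{M+1} · ∫₀^{|arg w|} dβ/‖1 + re^{iβ}‖`

(`norm_truncBinom_sub_cpow_le`; arc form `norm_truncBinom_sub_cpow_le_arc`; all objects INLINE in the shape of
`WindowEGF.integralRepr`, no definitions). Proof: integrate
`(G_M)′(t) = ½C t^M (1+t)^{−N−1}` (`G_M = T_M·(1+·)^{−N}`, part I) along `0 → r` (part I, §4) and along the arc
`t = re^{iβ}`, `0 ≤ β ≤ α = arg w ≤ π`, on which `|1+t| ≥ |1+w|` so that `|(1+w)^N/(1+t)^{N+1}| ≤ 1/|1+t|` (part II);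
the endpoint may lie ON the cut (`w < −1`), handled by the one-sided FTC with closed upper half-plane continuity; the
lower half-plane by conjugation (`T_M` has real coefficients). The first term is the «bulk» branch `(1+w)^N` times an
astronomically small factor; the second is the «endpoint»/Szegő branch `≍ C·r^{M}` that carries the top coefficient
`binom(M−½,M)σ^M μ₀` of `μ_{2M}F_M` — with the majorants of part II it gives
`|I − J_bulk| ≤ e^{M[log θ + 1/(2υ) − log(1−θ)]}·main ≈ e^{−0.53M}·main` at `θ = 7/20`, uniformly in `arg s`
(checked in exact rational arithmetic for `M ≤ 40`, seat folder `work/num/tm_check2.py`).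

WHAT THIS IS NOT: elementary analysis of a polynomial; nothing here bears on the zeros of `ζ` or the truth of RH.
References: Szegő 1924 (sections of power series); [GORZPNAS2019].
-/

noncomputable section
-- D-0017: `Summit.RiemannHypothesis.RiemannHypothesis.…` duplicates the namespace BY DESIGN (single-problem summit).
set_option linter.dupNamespace false

namespace Summit.RiemannHypothesis.RiemannHypothesis.Theorems.JensenPolynomials.WindowEGF

open Complex MeasureTheory Set Filter Finset
open scoped Real Topology ComplexConjugate

/-! ## 1. The arc form -/

/-- The norm of `G_M′`. -/
theorem norm_truncBinomG' (M : ℕ) (z : ℂ) :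
    ‖(((((descPochhammer ℝ M).eval ((M : ℝ) - 1 / 2) / (Nat.factorial M : ℝ)) / 2 : ℝ) : ℂ) * z ^ M * (1 + z) ^ (-((((M : ℝ) - 1 / 2) : ℝ) : ℂ) - 1))‖ = ((descPochhammer ℝ M).eval ((M : ℝ) - 1 / 2) / (Nat.factorial M : ℝ)) / 2 * ‖z‖ ^ M * ‖1 + z‖ ^ (-(((M : ℝ) - 1 / 2)) - 1) := by
  have hC : 0 ≤ ((descPochhammer ℝ M).eval ((M : ℝ) - 1 / 2) / (Nat.factorial M : ℝ)) / 2 := by have := halfBinom_pos (le_refl M); positivity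
  have hexp : (-((((M : ℝ) - 1 / 2) : ℝ) : ℂ) - 1) = (((-(((M : ℝ) - 1 / 2)) - 1 : ℝ)) : ℂ) := by push_cast; ring
  rw [norm_mul, norm_mul, norm_pow, hexp, Complex.norm_cpow_real, Complex.norm_real, Real.norm_of_nonneg hC]

/-- **Two-branch bound, arc form.** For `M ≥ 1`, `r > 0`, `0 ≤ α ≤ π` and `w = r e^{iα} ≠ −1`:
`‖T_M(w) − (1+w)^{M−½}‖ ≤ ‖1+w‖^{M−½}·binom(M−½,M) r^{M+1}/(2(M+1)) + ½binom(M−½,M) r^{M+1}·∫₀^α dβ/‖1 + re^{iβ}‖`. -/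
theorem norm_truncBinom_sub_cpow_le_arc (M : ℕ) (hM : 1 ≤ M) {r α : ℝ} (hr : 0 < r) (hα0 : 0 ≤ α)
    (hαπ : α ≤ π) (hw : 1 + ((r : ℂ) * Complex.exp ((α : ℂ) * I)) ≠ 0) :
    ‖(∑ k ∈ Finset.range (M + 1), ((((descPochhammer ℝ k).eval ((M : ℝ) - 1 / 2) / (Nat.factorial k : ℝ)) : ℝ) : ℂ) * (((r : ℂ) * Complex.exp ((α : ℂ) * I))) ^ k) - (1 + ((r : ℂ) * Complex.exp ((α : ℂ) * I))) ^ ((((M : ℝ) - 1 / 2) : ℝ) : ℂ)‖ ≤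
      ‖1 + ((r : ℂ) * Complex.exp ((α : ℂ) * I))‖ ^ (((M : ℝ) - 1 / 2)) * (((descPochhammer ℝ M).eval ((M : ℝ) - 1 / 2) / (Nat.factorial M : ℝ)) * r ^ (M + 1) / (2 * (M + 1))) +
        ((descPochhammer ℝ M).eval ((M : ℝ) - 1 / 2) / (Nat.factorial M : ℝ)) / 2 * r ^ (M + 1) * ∫ β in (0 : ℝ)..α, ‖1 + ((r : ℂ) * Complex.exp ((β : ℂ) * I))‖⁻¹ := by
  have hN0 : 0 ≤ ((M : ℝ) - 1 / 2) := by
    have : (1 : ℝ) ≤ M := by exact_mod_cast hM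
    linarith
  have hC0 : 0 ≤ ((descPochhammer ℝ M).eval ((M : ℝ) - 1 / 2) / (Nat.factorial M : ℝ)) / 2 := by have := halfBinom_pos (le_refl M); positivity
  have hCr : 0 ≤ ((descPochhammer ℝ M).eval ((M : ℝ) - 1 / 2) / (Nat.factorial M : ℝ)) / 2 * r ^ (M + 1) := mul_nonneg hC0 (pow_nonneg hr.le _)
  -- the two functions along the arc
  set h : ℝ → ℂ := fun β ↦ ((∑ k ∈ Finset.range (M + 1), ((((descPochhammer ℝ k).eval ((M : ℝ) - 1 / 2) / (Nat.factorial k : ℝ)) : ℝ) : ℂ) * (((r : ℂ) * Complex.exp ((β : ℂ) * I))) ^ k) * (1 + (((r : ℂ) * Complex.exp ((β : ℂ) * I)))) ^ (-((((M : ℝ) - 1 / 2) : ℝ) : ℂ))) with hhdef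
  set h' : ℝ → ℂ := fun β ↦ (((((descPochhammer ℝ M).eval ((M : ℝ) - 1 / 2) / (Nat.factorial M : ℝ)) / 2 : ℝ) : ℂ) * (((r : ℂ) * Complex.exp ((β : ℂ) * I))) ^ M * (1 + (((r : ℂ) * Complex.exp ((β : ℂ) * I)))) ^ (-((((M : ℝ) - 1 / 2) : ℝ) : ℂ) - 1)) * (((r : ℂ) * Complex.exp ((β : ℂ) * I)) * I) with hh'def
  -- nonvanishing of `1 + r e^{iβ}` along the arc
  have hwpos : 0 < ‖1 + ((r : ℂ) * Complex.exp ((α : ℂ) * I))‖ := norm_pos_iff.mpr hw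
  have hne : ∀ β ∈ Set.Icc 0 α, 1 + ((r : ℂ) * Complex.exp ((β : ℂ) * I)) ≠ 0 := by
    intro β hβ
    have hle := norm_one_add_arcPt_anti hr.le hβ.1 hβ.2 hαπ
    exact norm_pos_iff.mp (lt_of_lt_of_le hwpos hle)
  -- continuity of h, h' on [0, α]
  have hcont : ContinuousOn h (Set.Icc 0 α) :=
    ((continuous_truncBinom M).comp (continuous_arcPt r)).continuousOn.mul
      (continuousOn_cpow_one_add_arcPt hr.le hαπ hne _)
  have hcont' : ContinuousOn h' (Set.Icc 0 α) := by
    apply ContinuousOn.mul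
    · apply ContinuousOn.mul
      · exact (continuous_const.mul ((continuous_arcPt r).pow M)).continuousOn
      · exact continuousOn_cpow_one_add_arcPt hr.le hαπ hne _
    · exact ((continuous_arcPt r).mul continuous_const).continuousOn
  -- the derivative at interior points
  have hderiv : ∀ β ∈ Set.Ioo 0 α, HasDerivAt h (h' β) β := by
    intro β hβ
    have hslit : 1 + ((r : ℂ) * Complex.exp ((β : ℂ) * I)) ∈ slitPlane :=
      one_add_arcPt_mem_slitPlane hr hβ.1 (lt_of_lt_of_le hβ.2 hαπ)
    exact (hasDerivAt_truncBinomG M hslit).comp β (hasDerivAt_arcPt r β)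
  have hIcc : Set.uIcc (0 : ℝ) α = Set.Icc 0 α := Set.uIcc_of_le hα0
  have hint : IntervalIntegrable h' volume 0 α := by
    apply ContinuousOn.intervalIntegrable
    rw [hIcc]; exact hcont'
  have hftc : ∫ β in (0 : ℝ)..α, h' β = h α - h 0 :=
    intervalIntegral.integral_eq_sub_of_hasDerivAt_of_le hα0 hcont hderiv hint
  -- the norm of h'
  have hnorm' : ∀ β, ‖h' β‖ = ((descPochhammer ℝ M).eval ((M : ℝ) - 1 / 2) / (Nat.factorial M : ℝ)) / 2 * r ^ (M + 1) * ‖1 + ((r : ℂ) * Complex.exp ((β : ℂ) * I))‖ ^ (-(((M : ℝ) - 1 / 2)) - 1) := by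
    intro β
    simp only [hh'def]
    rw [norm_mul, norm_truncBinomG', norm_arcPt hr.le, norm_mul, norm_arcPt hr.le, Complex.norm_I, mul_one]
    ring
  -- pointwise comparison on [0, α]
  have hpt : ∀ β ∈ Set.Icc 0 α, ‖1 + ((r : ℂ) * Complex.exp ((α : ℂ) * I))‖ ^ (((M : ℝ) - 1 / 2)) * ‖h' β‖ ≤
      ((descPochhammer ℝ M).eval ((M : ℝ) - 1 / 2) / (Nat.factorial M : ℝ)) / 2 * r ^ (M + 1) * ‖1 + ((r : ℂ) * Complex.exp ((β : ℂ) * I))‖⁻¹ := by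
    intro β hβ
    rw [hnorm' β]
    have hm : ‖1 + ((r : ℂ) * Complex.exp ((α : ℂ) * I))‖ ≤ ‖1 + ((r : ℂ) * Complex.exp ((β : ℂ) * I))‖ := norm_one_add_arcPt_anti hr.le hβ.1 hβ.2 hαπ
    have hmpos : 0 < ‖1 + ((r : ℂ) * Complex.exp ((β : ℂ) * I))‖ := lt_of_lt_of_le hwpos hm
    have h1 : ‖1 + ((r : ℂ) * Complex.exp ((α : ℂ) * I))‖ ^ (((M : ℝ) - 1 / 2)) ≤ ‖1 + ((r : ℂ) * Complex.exp ((β : ℂ) * I))‖ ^ (((M : ℝ) - 1 / 2)) :=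
      Real.rpow_le_rpow (norm_nonneg _) hm hN0
    have h2 : ‖1 + ((r : ℂ) * Complex.exp ((β : ℂ) * I))‖ ^ (((M : ℝ) - 1 / 2)) * ‖1 + ((r : ℂ) * Complex.exp ((β : ℂ) * I))‖ ^ (-(((M : ℝ) - 1 / 2)) - 1) = ‖1 + ((r : ℂ) * Complex.exp ((β : ℂ) * I))‖⁻¹ := by
      rw [← Real.rpow_add hmpos, show ((M : ℝ) - 1 / 2) + (-(((M : ℝ) - 1 / 2)) - 1) = -1 by ring, Real.rpow_neg_one]
    have h3 : 0 ≤ ‖1 + ((r : ℂ) * Complex.exp ((β : ℂ) * I))‖ ^ (-(((M : ℝ) - 1 / 2)) - 1) := Real.rpow_nonneg (norm_nonneg _) _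
    calc ‖1 + ((r : ℂ) * Complex.exp ((α : ℂ) * I))‖ ^ (((M : ℝ) - 1 / 2)) * (((descPochhammer ℝ M).eval ((M : ℝ) - 1 / 2) / (Nat.factorial M : ℝ)) / 2 * r ^ (M + 1) * ‖1 + ((r : ℂ) * Complex.exp ((β : ℂ) * I))‖ ^ (-(((M : ℝ) - 1 / 2)) - 1))
        = (((descPochhammer ℝ M).eval ((M : ℝ) - 1 / 2) / (Nat.factorial M : ℝ)) / 2 * r ^ (M + 1)) * (‖1 + ((r : ℂ) * Complex.exp ((α : ℂ) * I))‖ ^ (((M : ℝ) - 1 / 2)) * ‖1 + ((r : ℂ) * Complex.exp ((β : ℂ) * I))‖ ^ (-(((M : ℝ) - 1 / 2)) - 1)) := by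
          ring
      _ ≤ (((descPochhammer ℝ M).eval ((M : ℝ) - 1 / 2) / (Nat.factorial M : ℝ)) / 2 * r ^ (M + 1)) * (‖1 + ((r : ℂ) * Complex.exp ((β : ℂ) * I))‖ ^ (((M : ℝ) - 1 / 2)) * ‖1 + ((r : ℂ) * Complex.exp ((β : ℂ) * I))‖ ^ (-(((M : ℝ) - 1 / 2)) - 1)) := by
          gcongr
      _ = ((descPochhammer ℝ M).eval ((M : ℝ) - 1 / 2) / (Nat.factorial M : ℝ)) / 2 * r ^ (M + 1) * ‖1 + ((r : ℂ) * Complex.exp ((β : ℂ) * I))‖⁻¹ := by rw [h2]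
  -- integrability of the comparison functions
  have hJcont : ContinuousOn (fun β : ℝ ↦ ‖1 + ((r : ℂ) * Complex.exp ((β : ℂ) * I))‖⁻¹) (Set.Icc 0 α) := by
    intro β hβ
    have hc : ContinuousAt (fun b : ℝ ↦ ‖1 + ((r : ℂ) * Complex.exp ((b : ℂ) * I))‖) β :=
      ((continuous_const.add (continuous_arcPt r)).norm).continuousAt
    exact (hc.inv₀ (norm_ne_zero_iff.mpr (hne β hβ))).continuousWithinAt
  have hJint : IntervalIntegrable (fun β : ℝ ↦ ‖1 + ((r : ℂ) * Complex.exp ((β : ℂ) * I))‖⁻¹) volume 0 α := by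
    apply ContinuousOn.intervalIntegrable; rw [hIcc]; exact hJcont
  have hnint : IntervalIntegrable (fun β : ℝ ↦ ‖h' β‖) volume 0 α := hint.norm
  -- the integral comparison
  have hI1 : ‖1 + ((r : ℂ) * Complex.exp ((α : ℂ) * I))‖ ^ (((M : ℝ) - 1 / 2)) * ∫ β in (0 : ℝ)..α, ‖h' β‖ ≤
      ((descPochhammer ℝ M).eval ((M : ℝ) - 1 / 2) / (Nat.factorial M : ℝ)) / 2 * r ^ (M + 1) * ∫ β in (0 : ℝ)..α, ‖1 + ((r : ℂ) * Complex.exp ((β : ℂ) * I))‖⁻¹ := by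
    rw [← intervalIntegral.integral_const_mul, ← intervalIntegral.integral_const_mul]
    apply intervalIntegral.integral_mono_on hα0 (hnint.const_mul _) (hJint.const_mul _)
    intro β hβ
    exact hpt β hβ
  -- h 0 = G(r) = 1 + C/2 I_r
  have hh0 : h 0 = 1 + (((((descPochhammer ℝ M).eval ((M : ℝ) - 1 / 2) / (Nat.factorial M : ℝ)) / 2) * (∫ x in (0 : ℝ)..r, x ^ M * (1 + x) ^ (-(((M : ℝ) - 1 / 2)) - 1)) : ℝ) : ℂ) := by
    simp only [hhdef, Complex.ofReal_zero, zero_mul, Complex.exp_zero, mul_one]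
    exact truncBinomG_ofReal M hr.le
  obtain ⟨hI0, hIle⟩ := segInt_bounds M hr.le
  -- T w = h α · (1+w)^N
  have hTw : (∑ k ∈ Finset.range (M + 1), ((((descPochhammer ℝ k).eval ((M : ℝ) - 1 / 2) / (Nat.factorial k : ℝ)) : ℝ) : ℂ) * (((r : ℂ) * Complex.exp ((α : ℂ) * I))) ^ k) = h α * (1 + ((r : ℂ) * Complex.exp ((α : ℂ) * I))) ^ ((((M : ℝ) - 1 / 2) : ℝ) : ℂ) := by
    simp only [hhdef]
    rw [mul_assoc, ← Complex.cpow_add _ _ hw, neg_add_cancel, Complex.cpow_zero, mul_one]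
  have hPnorm : ‖(1 + ((r : ℂ) * Complex.exp ((α : ℂ) * I))) ^ ((((M : ℝ) - 1 / 2) : ℝ) : ℂ)‖ = ‖1 + ((r : ℂ) * Complex.exp ((α : ℂ) * I))‖ ^ (((M : ℝ) - 1 / 2)) :=
    Complex.norm_cpow_real _ _
  -- assemble
  have hsplit : (∑ k ∈ Finset.range (M + 1), ((((descPochhammer ℝ k).eval ((M : ℝ) - 1 / 2) / (Nat.factorial k : ℝ)) : ℝ) : ℂ) * (((r : ℂ) * Complex.exp ((α : ℂ) * I))) ^ k) - (1 + ((r : ℂ) * Complex.exp ((α : ℂ) * I))) ^ ((((M : ℝ) - 1 / 2) : ℝ) : ℂ) =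
      ((h α - h 0) + (h 0 - 1)) * (1 + ((r : ℂ) * Complex.exp ((α : ℂ) * I))) ^ ((((M : ℝ) - 1 / 2) : ℝ) : ℂ) := by
    rw [hTw]; ring
  have hA : ‖h α - h 0‖ ≤ ∫ β in (0 : ℝ)..α, ‖h' β‖ := by
    rw [← hftc]
    exact intervalIntegral.norm_integral_le_integral_norm hα0
  have hB : ‖h 0 - 1‖ = ((descPochhammer ℝ M).eval ((M : ℝ) - 1 / 2) / (Nat.factorial M : ℝ)) / 2 * (∫ x in (0 : ℝ)..r, x ^ M * (1 + x) ^ (-(((M : ℝ) - 1 / 2)) - 1)) := by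
    rw [hh0, add_sub_cancel_left, Complex.norm_real, Real.norm_of_nonneg (mul_nonneg hC0 hI0)]
  calc ‖(∑ k ∈ Finset.range (M + 1), ((((descPochhammer ℝ k).eval ((M : ℝ) - 1 / 2) / (Nat.factorial k : ℝ)) : ℝ) : ℂ) * (((r : ℂ) * Complex.exp ((α : ℂ) * I))) ^ k) - (1 + ((r : ℂ) * Complex.exp ((α : ℂ) * I))) ^ ((((M : ℝ) - 1 / 2) : ℝ) : ℂ)‖
      = ‖((h α - h 0) + (h 0 - 1)) * (1 + ((r : ℂ) * Complex.exp ((α : ℂ) * I))) ^ ((((M : ℝ) - 1 / 2) : ℝ) : ℂ)‖ := by rw [hsplit]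
    _ ≤ (‖h α - h 0‖ + ‖h 0 - 1‖) * ‖1 + ((r : ℂ) * Complex.exp ((α : ℂ) * I))‖ ^ (((M : ℝ) - 1 / 2)) := by
        rw [norm_mul, hPnorm]
        gcongr
        exact norm_add_le _ _
    _ ≤ ((∫ β in (0 : ℝ)..α, ‖h' β‖) + ((descPochhammer ℝ M).eval ((M : ℝ) - 1 / 2) / (Nat.factorial M : ℝ)) / 2 * (∫ x in (0 : ℝ)..r, x ^ M * (1 + x) ^ (-(((M : ℝ) - 1 / 2)) - 1))) * ‖1 + ((r : ℂ) * Complex.exp ((α : ℂ) * I))‖ ^ (((M : ℝ) - 1 / 2)) := by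
        rw [hB]; gcongr
    _ = ‖1 + ((r : ℂ) * Complex.exp ((α : ℂ) * I))‖ ^ (((M : ℝ) - 1 / 2)) * (((descPochhammer ℝ M).eval ((M : ℝ) - 1 / 2) / (Nat.factorial M : ℝ)) / 2 * (∫ x in (0 : ℝ)..r, x ^ M * (1 + x) ^ (-(((M : ℝ) - 1 / 2)) - 1))) +
          ‖1 + ((r : ℂ) * Complex.exp ((α : ℂ) * I))‖ ^ (((M : ℝ) - 1 / 2)) * ∫ β in (0 : ℝ)..α, ‖h' β‖ := by ring
    _ ≤ ‖1 + ((r : ℂ) * Complex.exp ((α : ℂ) * I))‖ ^ (((M : ℝ) - 1 / 2)) * (((descPochhammer ℝ M).eval ((M : ℝ) - 1 / 2) / (Nat.factorial M : ℝ)) / 2 * (r ^ (M + 1) / (M + 1))) +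
          ((descPochhammer ℝ M).eval ((M : ℝ) - 1 / 2) / (Nat.factorial M : ℝ)) / 2 * r ^ (M + 1) * ∫ β in (0 : ℝ)..α, ‖1 + ((r : ℂ) * Complex.exp ((β : ℂ) * I))‖⁻¹ := by
        gcongr
    _ = ‖1 + ((r : ℂ) * Complex.exp ((α : ℂ) * I))‖ ^ (((M : ℝ) - 1 / 2)) * (((descPochhammer ℝ M).eval ((M : ℝ) - 1 / 2) / (Nat.factorial M : ℝ)) * r ^ (M + 1) / (2 * (M + 1))) +
          ((descPochhammer ℝ M).eval ((M : ℝ) - 1 / 2) / (Nat.factorial M : ℝ)) / 2 * r ^ (M + 1) * ∫ β in (0 : ℝ)..α, ‖1 + ((r : ℂ) * Complex.exp ((β : ℂ) * I))‖⁻¹ := by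
        have hM1 : ((M : ℝ) + 1) ≠ 0 := by positivity
        have hq : ((descPochhammer ℝ M).eval ((M : ℝ) - 1 / 2) / (Nat.factorial M : ℝ)) / 2 * (r ^ (M + 1) / (M + 1)) = ((descPochhammer ℝ M).eval ((M : ℝ) - 1 / 2) / (Nat.factorial M : ℝ)) * r ^ (M + 1) / (2 * (M + 1)) := by
          field_simp
        rw [hq]

/-! ## 2. The general point `w ≠ 0, −1` (polar form, conjugation) -/

/-- `T_M` has real coefficients: `T_M(conj w) = conj T_M(w)`. -/
theorem truncBinom_conj (M : ℕ) (w : ℂ) : (∑ k ∈ Finset.range (M + 1), ((((descPochhammer ℝ k).eval ((M : ℝ) - 1 / 2) / (Nat.factorial k : ℝ)) : ℝ) : ℂ) * (conj w) ^ k) = conj ((∑ k ∈ Finset.range (M + 1), ((((descPochhammer ℝ k).eval ((M : ℝ) - 1 / 2) / (Nat.factorial k : ℝ)) : ℝ) : ℂ) * w ^ k)) := by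
  rw [map_sum]
  refine Finset.sum_congr rfl fun k _ ↦ ?_
  rw [map_mul, map_pow, Complex.conj_ofReal]

/-- **Two-branch bound, general form.** For `M ≥ 1` and `w ∉ {0, −1}`, with `r = ‖w‖`:
`‖T_M(w) − (1+w)^{M−½}‖ ≤ ‖1+w‖^{M−½}·binom(M−½,M) r^{M+1}/(2(M+1)) + ½binom(M−½,M) r^{M+1}·∫₀^{|arg w|} dβ/‖1+re^{iβ}‖`.
-/
theorem norm_truncBinom_sub_cpow_le (M : ℕ) (hM : 1 ≤ M) {w : ℂ} (hw0 : w ≠ 0) (hw1 : 1 + w ≠ 0) :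
    ‖(∑ k ∈ Finset.range (M + 1), ((((descPochhammer ℝ k).eval ((M : ℝ) - 1 / 2) / (Nat.factorial k : ℝ)) : ℝ) : ℂ) * w ^ k) - (1 + w) ^ ((((M : ℝ) - 1 / 2) : ℝ) : ℂ)‖ ≤
      ‖1 + w‖ ^ (((M : ℝ) - 1 / 2)) * (((descPochhammer ℝ M).eval ((M : ℝ) - 1 / 2) / (Nat.factorial M : ℝ)) * ‖w‖ ^ (M + 1) / (2 * (M + 1))) +
        ((descPochhammer ℝ M).eval ((M : ℝ) - 1 / 2) / (Nat.factorial M : ℝ)) / 2 * ‖w‖ ^ (M + 1) * ∫ β in (0 : ℝ)..|arg w|, ‖1 + ((‖w‖ : ℂ) * Complex.exp ((β : ℂ) * I))‖⁻¹ := by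
  have hr : 0 < ‖w‖ := norm_pos_iff.mpr hw0
  rcases le_or_gt 0 w.im with him | him
  · -- upper half-plane: w = ((‖w‖ : ℂ) * Complex.exp (((arg w) : ℂ) * I)), arg w ∈ [0, π]
    have hα0 : 0 ≤ arg w := Complex.arg_nonneg_iff.mpr him
    have hαπ : arg w ≤ π := Complex.arg_le_pi w
    have habs : |arg w| = arg w := abs_of_nonneg hα0
    have hw' : 1 + ((‖w‖ : ℂ) * Complex.exp (((arg w) : ℂ) * I)) ≠ 0 := by rwa [Complex.norm_mul_exp_arg_mul_I]
    have h := norm_truncBinom_sub_cpow_le_arc M hM hr hα0 hαπ hw'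
    rw [Complex.norm_mul_exp_arg_mul_I] at h
    rwa [habs]
  · -- lower half-plane: conjugate
    set w' : ℂ := conj w with hw'def
    have him' : 0 ≤ w'.im := by rw [hw'def, Complex.conj_im]; linarith
    have hnorm' : ‖w'‖ = ‖w‖ := by rw [hw'def, Complex.norm_conj]
    have hargw : arg w < 0 := Complex.arg_neg_iff.mpr him
    have harg' : arg w' = -arg w := by
      rw [hw'def, Complex.arg_conj]
      have : arg w ≠ π := by intro h; rw [h] at hargw; linarith [Real.pi_pos]
      simp [this]
    have habs : |arg w| = arg w' := by rw [harg', abs_of_neg hargw]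
    have hα0 : 0 ≤ arg w' := Complex.arg_nonneg_iff.mpr him'
    have hαπ : arg w' ≤ π := Complex.arg_le_pi w'
    have hr' : 0 < ‖w'‖ := by rwa [hnorm']
    have h1w' : 1 + w' = conj (1 + w) := by rw [hw'def, map_add, map_one]
    have hw1' : 1 + w' ≠ 0 := by
      rw [h1w']; exact (map_ne_zero_iff _ (RingHom.injective _)).mpr hw1
    have hw'' : 1 + ((‖w'‖ : ℂ) * Complex.exp (((arg w') : ℂ) * I)) ≠ 0 := by rwa [Complex.norm_mul_exp_arg_mul_I]
    have h := norm_truncBinom_sub_cpow_le_arc M hM hr' hα0 hαπ hw''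
    rw [Complex.norm_mul_exp_arg_mul_I] at h
    -- translate back to w
    have harg1 : (1 + w).arg ≠ π := by
      intro h1
      have : (1 + w).im = 0 := (Complex.arg_eq_pi_iff.mp h1).2
      simp at this; linarith
    have hconj : (∑ k ∈ Finset.range (M + 1), ((((descPochhammer ℝ k).eval ((M : ℝ) - 1 / 2) / (Nat.factorial k : ℝ)) : ℝ) : ℂ) * w' ^ k) - (1 + w') ^ ((((M : ℝ) - 1 / 2) : ℝ) : ℂ) =
        conj ((∑ k ∈ Finset.range (M + 1), ((((descPochhammer ℝ k).eval ((M : ℝ) - 1 / 2) / (Nat.factorial k : ℝ)) : ℝ) : ℂ) * w ^ k) - (1 + w) ^ ((((M : ℝ) - 1 / 2) : ℝ) : ℂ)) := by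
      rw [map_sub, ← truncBinom_conj, h1w', Complex.conj_cpow _ _ harg1, Complex.conj_ofReal]
    rw [hconj, Complex.norm_conj, h1w', Complex.norm_conj, hnorm'] at h
    rwa [habs]

end Summit.RiemannHypothesis.RiemannHypothesis.Theorems.JensenPolynomials.WindowEGF
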